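import Summits.QuantumFields.YangMills.Theorems.AllWindowsColdBoxBoxHighLineGaussianChartWickFintype

/-!
# T-S5.4w‴ «integrability of polynomial moments in the Gaussian chart, and the colour-summed covariance of squares»

Corollary file of ✓4w/4w′/4w″ (`GaussianChartWick`, `…PosDef`, `…Fintype`) for step (2) of the XL comparison stubs S5 (LINE-19
⟨stmt-QuantumFields-24004⟩/⟨24335⟩ `stub_landauSecondOrder`) and U5 (LINE-20 ⟨24336⟩).  The Wick identities of 4w–4w″ hold for every
integrand (Bochner junk values on both sides), but the second-order expansion SPLITS sums of Gaussian integrals (colour sums, sums over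
plaquettes / vertex positions), which needs INTEGRABILITY of `(∏_i ℓ_i ⬝ᵥ v) · exp(−β vᵀPv)`:

* `integrable_mul_exp_iff` — `v ↦ F(v)·exp(−β‖Mv‖²)` is Lebesgue-integrable iff `w ↦ F(M⁻¹w)` is integrable under `P_β = ⊗ⁿ N(0,(2β)⁻¹)`
  (measure identity of ✓4w + linear change of variables);
* `integrable_prod_dotProduct_mul_exp` (`‖Mv‖²` form), `…_quadForm` (`P` positive definite, `Fin n`), **`…_quadForm'`** (any finite index `ι`):
  products of linear forms against the Gaussian weight are integrable (the tree's ✓`GaussianWick.integrable_prod` for the legs under `P_β`);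
* **`integral_sumSq_mul_sumSq_mul_exp_quadForm'`** — for two finite families of linear forms `x_a`, `y_b` (think: the three colour components of
  the linearised circulations of two plaquettes), with `Z = √(π/β)^{|ι|}/√det P` and `S(a,b) = (2β)⁻¹ a ⬝ᵥ P⁻¹ b`:
  `Z·∫(Σ_a (x_a⬝v)²)(Σ_b (y_b⬝v)²)e^{−βvᵀPv} = (∫Σ_a(x_a⬝v)²e^{…})(∫Σ_b(y_b⬝v)²e^{…}) + Z²·2·Σ_{a,b} S(x_a,y_b)²`
  — i.e. `Cov_G(Σ_a X_a², Σ_b Y_b²) = 2 Σ_{a,b} Cov_G(X_a,Y_b)²`, the shape of S5's Gaussian MAIN TERM `Cov_G(c₂(p), c₂(q))` with `c₂ = ½Σ_a(λ⬝B^a)²`.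

Tree (✓GaussianChartWickFintype and its imports) + Mathlib; no definitions.  HONEST LABEL: infrastructure for step (2) of the XL stubs S5/U5;
T-S5.4J, S5, U5, ⟨24004⟩ ⟨24335⟩ ⟨24336⟩ remain OPEN; no summit is proved; the Yang–Mills mass gap is NOT proved by this file.
Seat ym-line-sfw-p2 g77 (LEAD, cell ym-idea-1).
-/

set_option autoImplicit false

noncomputable section

open MeasureTheory ProbabilityTheory Matrix Finset
open scoped NNReal ENNReal

namespace Summit.QuantumFields.YangMills.Theorems.AllWindowsColdBoxBoxHighLine

namespace GaussianChartWick

variable {n : ℕ}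

/-- **Integrability transfer**: `v ↦ F(v)·exp(−β‖Mv‖²)` is Lebesgue-integrable iff `w ↦ F(M⁻¹ w)` is `P_β`-integrable. -/
theorem integrable_mul_exp_iff (M : Matrix (Fin n) (Fin n) ℝ) (hM : M.det ≠ 0) {β : ℝ} (hβ : 0 < β) (F : (Fin n → ℝ) → ℝ) :
    Integrable (fun v : Fin n → ℝ => F v * Real.exp (-(β * (M *ᵥ v ⬝ᵥ M *ᵥ v)))) ↔
      Integrable (fun w : Fin n → ℝ => F (M⁻¹ *ᵥ w)) (Measure.pi (fun _ : Fin n => gaussianReal 0 (Real.toNNReal (2 * β)⁻¹))) := by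
  have hMu : IsUnit M.det := isUnit_iff_ne_zero.mpr hM
  obtain ⟨e, he, -⟩ := exists_measurableEquiv_mulVec M hM
  set g : (Fin n → ℝ) → ℝ := fun w => Real.exp (-(β * (w ⬝ᵥ w))) * F (M⁻¹ *ᵥ w) with hg
  have h1 : (fun v : Fin n → ℝ => F v * Real.exp (-(β * (M *ᵥ v ⬝ᵥ M *ᵥ v)))) = g ∘ e := by
    funext v
    show F v * _ = Real.exp (-(β * (e v ⬝ᵥ e v))) * F (M⁻¹ *ᵥ e v)
    rw [he, Matrix.mulVec_mulVec, Matrix.nonsing_inv_mul _ hMu, Matrix.one_mulVec, mul_comm]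
  have hmap : Measure.map e (volume : Measure (Fin n → ℝ)) = ENNReal.ofReal |M.det|⁻¹ • volume := by
    have hfe : (e : (Fin n → ℝ) → (Fin n → ℝ)) = Matrix.toLin' M := by
      funext v; rw [he, Matrix.toLin'_apply]
    rw [hfe, Real.map_matrix_volume_pi_eq_smul_volume_pi hM, abs_inv]
  have hc0 : ENNReal.ofReal |M.det|⁻¹ ≠ 0 := by
    rw [ENNReal.ofReal_ne_zero_iff]; positivity
  -- step 1: change of variables
  rw [h1, ← e.measurableEmbedding.integrable_map_iff, hmap, integrable_smul_measure hc0 ENNReal.ofReal_ne_top]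
  -- step 2: the density
  have hdens := integrable_withDensity_iff_integrable_smul' (μ := (volume : Measure (Fin n → ℝ)))
    (f := fun w => ENNReal.ofReal (Real.exp (-(β * (w ⬝ᵥ w))))) (by fun_prop)
    (Filter.Eventually.of_forall fun _ => ENNReal.ofReal_lt_top) (g := fun w => F (M⁻¹ *ᵥ w))
  simp only [ENNReal.toReal_ofReal (Real.exp_pos _).le, smul_eq_mul] at hdens
  show Integrable (fun w => Real.exp (-(β * (w ⬝ᵥ w))) * F (M⁻¹ *ᵥ w)) volume ↔ _
  rw [← hdens, withDensity_exp_eq_smul_pi hβ,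
    integrable_smul_measure (by rw [ENNReal.ofReal_ne_zero_iff]; positivity) ENNReal.ofReal_ne_top]

/-- Products of linear forms against `exp(−β‖Mv‖²)` are integrable. -/
theorem integrable_prod_dotProduct_mul_exp (M : Matrix (Fin n) (Fin n) ℝ) (hM : M.det ≠ 0) {β : ℝ} (hβ : 0 < β)
    {κ : Type*} (s : Finset κ) (ℓ : κ → (Fin n → ℝ)) :
    Integrable (fun v : Fin n → ℝ => (∏ i ∈ s, (ℓ i ⬝ᵥ v)) * Real.exp (-(β * (M *ᵥ v ⬝ᵥ M *ᵥ v)))) := by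
  rw [integrable_mul_exp_iff M hM hβ]
  exact Literature.Probability.Distributions.GaussianWick.integrable_prod (isGaussianProcess_legs M β) s ℓ

end GaussianChartWick

open GaussianChartWick

/-- Products of linear forms against `exp(−β vᵀPv)` (`P` positive definite, `Fin n`) are integrable. -/
theorem integrable_prod_dotProduct_mul_exp_quadForm (n : ℕ) (P : Matrix (Fin n) (Fin n) ℝ) (hP : P.PosDef) {β : ℝ} (hβ : 0 < β)
    {κ : Type*} (s : Finset κ) (ℓ : κ → (Fin n → ℝ)) :
    Integrable (fun v : Fin n → ℝ => (∏ i ∈ s, (ℓ i ⬝ᵥ v)) * Real.exp (-(β * (v ⬝ᵥ P *ᵥ v)))) := by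
  obtain ⟨M, hMP, hM⟩ := exists_transpose_mul_self_of_posDef P hP
  have h := integrable_prod_dotProduct_mul_exp M hM hβ s ℓ
  simpa only [mulVec_dotProduct_mulVec_of_transpose_mul_self hMP] using h

section Fintype

variable {ι : Type*} [Fintype ι]

/-- **Products of linear forms against `exp(−β vᵀPv)` over ANY finite index type are integrable.** -/
theorem integrable_prod_dotProduct_mul_exp_quadForm' (P : Matrix ι ι ℝ) (hP : P.PosDef) {β : ℝ} (hβ : 0 < β)
    {κ : Type*} (s : Finset κ) (ℓ : κ → (ι → ℝ)) :
    Integrable (fun v : ι → ℝ => (∏ i ∈ s, (ℓ i ⬝ᵥ v)) * Real.exp (-(β * (v ⬝ᵥ P *ᵥ v)))) := by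
  have hmp := volume_measurePreserving_piCongrLeft (fun _ : ι => ℝ) (Fintype.equivFin ι).symm
  have h := integrable_prod_dotProduct_mul_exp_quadForm _ _ (posDef_submatrix_equivFin P hP) hβ s
    (fun i j => ℓ i ((Fintype.equivFin ι).symm j))
  rw [← hmp.integrable_comp_emb (MeasurableEquiv.measurableEmbedding _)]
  have hfun : ((fun v : ι → ℝ => (∏ i ∈ s, (ℓ i ⬝ᵥ v)) * Real.exp (-(β * (v ⬝ᵥ P *ᵥ v)))) ∘
      (MeasurableEquiv.piCongrLeft (fun _ : ι => ℝ) (Fintype.equivFin ι).symm)) =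
      fun w => (∏ i ∈ s, ((fun j => ℓ i ((Fintype.equivFin ι).symm j)) ⬝ᵥ w)) *
        Real.exp (-(β * (w ⬝ᵥ (P.submatrix (Fintype.equivFin ι).symm (Fintype.equivFin ι).symm) *ᵥ w))) := by
    funext w
    have hw : (MeasurableEquiv.piCongrLeft (fun _ : ι => ℝ) (Fintype.equivFin ι).symm w) = fun i => w (Fintype.equivFin ι i) := by
      funext i; exact piCongrLeft_equivFin_symm_apply w i
    simp only [Function.comp_apply, hw, quadForm_comp_equivFin, dotProduct_comp_equivFin]
  rw [hfun]
  exact h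

/-- The single-square case used below: `(a⬝v)²(b⬝v)²·e^{−βvᵀPv}` and `(a⬝v)²·e^{−βvᵀPv}` are integrable. -/
theorem integrable_sq_mul_sq_mul_exp_quadForm' (P : Matrix ι ι ℝ) (hP : P.PosDef) {β : ℝ} (hβ : 0 < β) (a b : ι → ℝ) :
    Integrable (fun v : ι → ℝ => (a ⬝ᵥ v) ^ 2 * (b ⬝ᵥ v) ^ 2 * Real.exp (-(β * (v ⬝ᵥ P *ᵥ v)))) := by
  have h := integrable_prod_dotProduct_mul_exp_quadForm' P hP hβ (Finset.univ : Finset (Fin 4)) ![a, a, b, b]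
  refine h.congr (Filter.Eventually.of_forall fun v => ?_)
  simp [Fin.prod_univ_four]
  ring

/-- `(a⬝v)²·e^{−βvᵀPv}` is integrable. -/
theorem integrable_sq_mul_exp_quadForm' (P : Matrix ι ι ℝ) (hP : P.PosDef) {β : ℝ} (hβ : 0 < β) (a : ι → ℝ) :
    Integrable (fun v : ι → ℝ => (a ⬝ᵥ v) ^ 2 * Real.exp (-(β * (v ⬝ᵥ P *ᵥ v)))) := by
  have h := integrable_prod_dotProduct_mul_exp_quadForm' P hP hβ (Finset.univ : Finset (Fin 2)) ![a, a]
  refine h.congr (Filter.Eventually.of_forall fun v => ?_)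
  simp [Fin.prod_univ_two]
  ring

variable [DecidableEq ι]

/-- **Colour-summed covariance of squares** (the shape of S5's Gaussian main term `Cov_G(c₂(p), c₂(q))`): for finite families of linear
forms `x_a`, `y_b`, with `Z = √(π/β)^{|ι|}/√det P` and `S(u,w) = (2β)⁻¹ u ⬝ᵥ P⁻¹ w`,
`Z·∫(Σ_a (x_a⬝v)²)(Σ_b (y_b⬝v)²)e^{−βvᵀPv} = (∫Σ_a(x_a⬝v)²e^{−βvᵀPv})(∫Σ_b(y_b⬝v)²e^{−βvᵀPv}) + Z²·2·Σ_aΣ_b S(x_a,y_b)²`. -/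
theorem integral_sumSq_mul_sumSq_mul_exp_quadForm' (P : Matrix ι ι ℝ) (hP : P.PosDef) {β : ℝ} (hβ : 0 < β)
    {κ κ' : Type*} (A : Finset κ) (B : Finset κ') (x : κ → (ι → ℝ)) (y : κ' → (ι → ℝ)) :
    Real.sqrt (Real.pi / β) ^ Fintype.card ι / Real.sqrt P.det *
        ∫ v : ι → ℝ, (∑ a ∈ A, (x a ⬝ᵥ v) ^ 2) * (∑ b ∈ B, (y b ⬝ᵥ v) ^ 2) * Real.exp (-(β * (v ⬝ᵥ P *ᵥ v))) =
      (∫ v : ι → ℝ, (∑ a ∈ A, (x a ⬝ᵥ v) ^ 2) * Real.exp (-(β * (v ⬝ᵥ P *ᵥ v)))) *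
        (∫ v : ι → ℝ, (∑ b ∈ B, (y b ⬝ᵥ v) ^ 2) * Real.exp (-(β * (v ⬝ᵥ P *ᵥ v)))) +
      (Real.sqrt (Real.pi / β) ^ Fintype.card ι / Real.sqrt P.det) ^ 2 *
        (2 * ∑ a ∈ A, ∑ b ∈ B, ((2 * β)⁻¹ * (x a ⬝ᵥ (P⁻¹ *ᵥ y b))) ^ 2) := by
  -- expand the product of sums and integrate termwise
  have hexp : ∀ v : ι → ℝ, (∑ a ∈ A, (x a ⬝ᵥ v) ^ 2) * (∑ b ∈ B, (y b ⬝ᵥ v) ^ 2) * Real.exp (-(β * (v ⬝ᵥ P *ᵥ v))) =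
      ∑ a ∈ A, ∑ b ∈ B, (x a ⬝ᵥ v) ^ 2 * (y b ⬝ᵥ v) ^ 2 * Real.exp (-(β * (v ⬝ᵥ P *ᵥ v))) := by
    intro v
    rw [Finset.sum_mul_sum, Finset.sum_mul]
    refine Finset.sum_congr rfl fun a _ => ?_
    rw [Finset.sum_mul]
  have hx : ∀ v : ι → ℝ, (∑ a ∈ A, (x a ⬝ᵥ v) ^ 2) * Real.exp (-(β * (v ⬝ᵥ P *ᵥ v))) =
      ∑ a ∈ A, (x a ⬝ᵥ v) ^ 2 * Real.exp (-(β * (v ⬝ᵥ P *ᵥ v))) := fun v => by rw [Finset.sum_mul]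
  have hy : ∀ v : ι → ℝ, (∑ b ∈ B, (y b ⬝ᵥ v) ^ 2) * Real.exp (-(β * (v ⬝ᵥ P *ᵥ v))) =
      ∑ b ∈ B, (y b ⬝ᵥ v) ^ 2 * Real.exp (-(β * (v ⬝ᵥ P *ᵥ v))) := fun v => by rw [Finset.sum_mul]
  simp_rw [hexp, hx, hy]
  rw [integral_finsetSum _ fun a _ => integrable_finsetSum _ fun b _ => integrable_sq_mul_sq_mul_exp_quadForm' P hP hβ (x a) (y b)]
  simp_rw [integral_finsetSum _ fun b _ => integrable_sq_mul_sq_mul_exp_quadForm' P hP hβ _ (y b)]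
  rw [integral_finsetSum _ fun a _ => integrable_sq_mul_exp_quadForm' P hP hβ (x a),
    integral_finsetSum _ fun b _ => integrable_sq_mul_exp_quadForm' P hP hβ (y b)]
  -- each term
  have hterm : ∀ a b, Real.sqrt (Real.pi / β) ^ Fintype.card ι / Real.sqrt P.det *
      ∫ v : ι → ℝ, (x a ⬝ᵥ v) ^ 2 * (y b ⬝ᵥ v) ^ 2 * Real.exp (-(β * (v ⬝ᵥ P *ᵥ v))) =
      (∫ v : ι → ℝ, (x a ⬝ᵥ v) ^ 2 * Real.exp (-(β * (v ⬝ᵥ P *ᵥ v)))) *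
        (∫ v : ι → ℝ, (y b ⬝ᵥ v) ^ 2 * Real.exp (-(β * (v ⬝ᵥ P *ᵥ v)))) +
      (Real.sqrt (Real.pi / β) ^ Fintype.card ι / Real.sqrt P.det) ^ 2 * (2 * ((2 * β)⁻¹ * (x a ⬝ᵥ (P⁻¹ *ᵥ y b))) ^ 2) :=
    fun a b => integral_sq_mul_sq_mul_exp_quadForm' P hP hβ (x a) (y b)
  calc Real.sqrt (Real.pi / β) ^ Fintype.card ι / Real.sqrt P.det *
        ∑ a ∈ A, ∑ b ∈ B, ∫ v : ι → ℝ, (x a ⬝ᵥ v) ^ 2 * (y b ⬝ᵥ v) ^ 2 * Real.exp (-(β * (v ⬝ᵥ P *ᵥ v)))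
      = ∑ a ∈ A, ∑ b ∈ B, Real.sqrt (Real.pi / β) ^ Fintype.card ι / Real.sqrt P.det *
          ∫ v : ι → ℝ, (x a ⬝ᵥ v) ^ 2 * (y b ⬝ᵥ v) ^ 2 * Real.exp (-(β * (v ⬝ᵥ P *ᵥ v))) := by
        rw [Finset.mul_sum]
        exact Finset.sum_congr rfl fun a _ => by rw [Finset.mul_sum]
    _ = ∑ a ∈ A, ∑ b ∈ B, ((∫ v : ι → ℝ, (x a ⬝ᵥ v) ^ 2 * Real.exp (-(β * (v ⬝ᵥ P *ᵥ v)))) *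
          (∫ v : ι → ℝ, (y b ⬝ᵥ v) ^ 2 * Real.exp (-(β * (v ⬝ᵥ P *ᵥ v)))) +
          (Real.sqrt (Real.pi / β) ^ Fintype.card ι / Real.sqrt P.det) ^ 2 * (2 * ((2 * β)⁻¹ * (x a ⬝ᵥ (P⁻¹ *ᵥ y b))) ^ 2)) :=
        Finset.sum_congr rfl fun a _ => Finset.sum_congr rfl fun b _ => hterm a b
    _ = (∑ a ∈ A, ∑ b ∈ B, (∫ v : ι → ℝ, (x a ⬝ᵥ v) ^ 2 * Real.exp (-(β * (v ⬝ᵥ P *ᵥ v)))) *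
          (∫ v : ι → ℝ, (y b ⬝ᵥ v) ^ 2 * Real.exp (-(β * (v ⬝ᵥ P *ᵥ v))))) +
        ∑ a ∈ A, ∑ b ∈ B, (Real.sqrt (Real.pi / β) ^ Fintype.card ι / Real.sqrt P.det) ^ 2 *
          (2 * ((2 * β)⁻¹ * (x a ⬝ᵥ (P⁻¹ *ᵥ y b))) ^ 2) := by
        rw [← Finset.sum_add_distrib]
        exact Finset.sum_congr rfl fun a _ => Finset.sum_add_distrib
    _ = _ := by
        rw [Finset.sum_mul_sum]
        congr 1
        simp only [Finset.mul_sum]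

end Fintype

end Summit.QuantumFields.YangMills.Theorems.AllWindowsColdBoxBoxHighLine

end
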